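import Summits.Ventures.YMGap.Census.TwistCensusGerm
import HarnessLib

/-!
# Venture YMGap, track (b) census — the TOP END of the census polynomial: the «≤» half of the degree law (D) as a
# theorem, and the reduction of (D) ∧ (S∞) to one Haar-moment positivity

HONEST FRAMING: venture file of the cell `pub-ymgap` (QuantumFields programme), track (b).  Exact statements about the
one-character census polynomials of `Census/TwistCensusObjects.lean` on a rectangular torus (any `d`); no sign of any Haar
moment is decided here; nothing about root locations, limits or physics.

Mechanism N-3 (ii) of HOME/STRUCTURE.md §4, made a theorem by the MIRROR of `TwistCensusGerm`: work with complements.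
With `P := L_i L_j`, `|Λ₂|` the number of plaquettes, `𝒱 = 𝒱_{ij}` the twist stack, `n := |𝒱|`:
* `card_stackAt` / `even_card_stackAt_symmDiff`: all parallel stacks have the same size, so two of them differ by an
  even set — hence the complement `Λ₂ ∖ S` of a contributing `S` ALSO meets the step coboundaries evenly
  (`le_card_compl_of_odd`: if `I(S) ≠ 0` and `|(Λ₂ ∖ S) ∩ 𝒱|` is odd then `|Λ₂ ∖ S| ≥ P`);
* `coeff_tilde_eq_zero`: the polynomial `D̃ := Z⁻_𝒱 − (−1)^n Z` has `coeff_m D̃ = 0` for `m > |Λ₂| − P`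
  (`natDegree_tilde_le`), and `N = D̃′Z − D̃Z′` (`twistCensusPoly_eq_tilde`), whence
* `natDegree_twistCensusPoly_le_degreeLaw` : **`deg N_{ij} ≤ 2|Λ₂| − 1 − L_iL_j`** — the «≤» half of
  `Conjectures.TwistCensusParity.DegreeLaw`, a theorem for every rectangular torus;
* `twistCensusPoly_coeff_degreeLaw` : for `P < |Λ₂|` (automatic when `d ≥ 3`) the coefficient of `N_{ij}` in the
  conjectured top degree `2|Λ₂| − 1 − P` equals `2·P·(−1)^n · cosheetMomentSum · (2^{|Λ₂|} I(Λ₂))` with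
  `cosheetMomentSum := Σ_{|T| = P, |T ∩ 𝒱| odd} 2^{|Λ₂| − P} I(Λ₂ ∖ T)` — so (D) («the degree IS `2|Λ₂| − 1 − P`») is
  EQUIVALENT to `cosheetMomentSum · I(Λ₂) ≠ 0`, and (D) ∧ (S∞) to `0 < cosheetMomentSum · I(Λ₂)` (mechanism: the
  contributing `T` are the `n` sheets, and `I(Λ₂) > 0`, `I(Λ₂ ∖ sheet) > 0`; those positivity statements are NOT proved here).

References: E. T. Tomboulis, arXiv:0707.2179 §6 (6.2)–(6.4) [cite: Tomboulis2007Confinement, §6 eqs. (6.2)–(6.4)];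
HOME/STRUCTURE.md §4 N-3; HOME/engine/census/TwistCensusParity/ (evidence: (D) 127/127, (S∞) 127/127 rows).
-/

noncomputable section

open MeasureTheory Finset Real Polynomial
open scoped BigOperators symmDiff
open Literature.MathematicalPhysics.QuantumLattice
open Literature.MathematicalPhysics.QuantumFieldTheory
open Literature.MathematicalPhysics.QuantumFieldTheory.Tomboulis2007

namespace Summit.Ventures.YMGap.Census

variable {d : ℕ} (Ls : Fin d → ℕ) [∀ i, NeZero (Ls i)] {i j : Fin d} (hij : i < j)

/-! ### All stacks have the same size -/

/-- Translation of the base point by a fixed vector (an embedding of the plaquettes). -/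
private def translate (v : RectTorusSite Ls) : RectPlaquette Ls ↪ RectPlaquette Ls :=
  ⟨fun p => (p.1 + v, p.2), fun p q h => by
    simp only [Prod.mk.injEq, add_left_inj] at h
    exact Prod.ext h.1 h.2⟩

/-- `stackAt a b` is the translate of `stackAt 0 0` by `a e_i + b e_j`. -/
theorem stackAt_eq_map (a : ZMod (Ls i)) (b : ZMod (Ls j)) :
    stackAt Ls hij a b = (stackAt Ls hij 0 0).map (translate Ls (Pi.single i a + Pi.single j b)) := by
  ext p
  simp only [Finset.mem_map, mem_stackAt]
  constructor
  · rintro ⟨hp, ha, hb⟩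
    refine ⟨(p.1 - (Pi.single i a + Pi.single j b), p.2), ⟨hp, ?_, ?_⟩, ?_⟩
    · simp [Pi.single_eq_of_ne hij.ne, ha]
    · simp [Pi.single_eq_of_ne hij.ne', hb]
    · simp [translate]
  · rintro ⟨q, ⟨hq, hqa, hqb⟩, rfl⟩
    refine ⟨hq, ?_, ?_⟩
    · simp [translate, Pi.single_eq_of_ne hij.ne, hqa]
    · simp [translate, Pi.single_eq_of_ne hij.ne', hqb]

/-- **All parallel stacks have the same number of plaquettes.** -/
theorem card_stackAt (a : ZMod (Ls i)) (b : ZMod (Ls j)) :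
    (stackAt Ls hij a b).card = (stackAt Ls hij 0 0).card := by
  rw [stackAt_eq_map, Finset.card_map]

/-- Two parallel stacks differ by a set of EVEN size (equal, or disjoint of the same size). -/
theorem even_card_stackAt_symmDiff (a a' : ZMod (Ls i)) (b b' : ZMod (Ls j)) :
    Even ((stackAt Ls hij a b) ∆ (stackAt Ls hij a' b')).card := by
  by_cases h : a = a' ∧ b = b'
  · obtain ⟨rfl, rfl⟩ := h
    simp [symmDiff_self]
  · have hdisj : Disjoint (stackAt Ls hij a b) (stackAt Ls hij a' b') := by
      rw [Finset.disjoint_left]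
      intro p hp hp'
      rw [mem_stackAt] at hp hp'
      exact h ⟨hp.2.1.symm.trans hp'.2.1, hp.2.2.symm.trans hp'.2.2⟩
    rw [hdisj.symmDiff_eq_sup, Finset.sup_eq_union, Finset.card_union_eq_card_add_card.mpr hdisj,
      card_stackAt Ls hij a b, card_stackAt Ls hij a' b']
    exact ⟨_, rfl⟩

/-! ### Complements of contributing plaquette sets -/

omit [∀ i, NeZero (Ls i)] in
/-- If `X` is even and `S ∩ X` is even then `(Λ₂ ∖ S) ∩ X` is even (plumbing). -/
private theorem even_card_compl_inter [∀ i, NeZero (Ls i)] {X S : Finset (RectPlaquette Ls)} (hX : Even X.card)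
    (hS : Even (S ∩ X).card) : Even ((univ \ S) ∩ X).card := by
  have h1 : (univ \ S) ∩ X = X \ S := by
    ext p
    simp only [Finset.mem_inter, Finset.mem_sdiff, Finset.mem_univ, true_and]
    tauto
  have h2 : (X \ S).card + (X ∩ S).card = X.card := Finset.card_sdiff_add_card_inter X S
  rw [Finset.inter_comm] at hS
  rw [h1]
  rw [Nat.even_iff] at hX hS ⊢
  omega

/-- **If `I(S) ≠ 0` and the complement `Λ₂ ∖ S` meets the twist stack an odd number of times, then `|Λ₂ ∖ S| ≥ L_iL_j`**
(the complement inherits even step-coboundary intersections because two parallel stacks differ by an even set). -/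
theorem le_card_compl_of_odd {S : Finset (RectPlaquette Ls)} (hS : rectCharMoment Ls S ≠ 0)
    (hodd : Odd ((univ \ S) ∩ rectVortexSheet Ls i j hij).card) : Ls i * Ls j ≤ (univ \ S).card := by
  refine le_card_of_even_of_odd Ls hij (fun a b => ?_) (fun a b => ?_) hodd
  · refine even_card_compl_inter Ls ?_ (even_inter_rectCoboundary_of_rectCharMoment_ne_zero Ls hS _)
    rw [rectCoboundary_jLinksAt Ls hij]
    exact even_card_stackAt_symmDiff Ls hij _ _ _ _
  · refine even_card_compl_inter Ls ?_ (even_inter_rectCoboundary_of_rectCharMoment_ne_zero Ls hS _)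
    rw [rectCoboundary_iLinksAt Ls hij]
    exact even_card_stackAt_symmDiff Ls hij _ _ _ _

/-- `L_i L_j ≤ |Λ₂|`: the `(i, j)`-plaquettes at the base points `a e_i + b e_j` are pairwise distinct. -/
theorem mul_le_card_rectPlaquette (i' j' : Fin d) (h : i' < j') : Ls i' * Ls j' ≤ Fintype.card (RectPlaquette Ls) := by
  have hf : Function.Injective fun c : ZMod (Ls i') × ZMod (Ls j') =>
      ((Pi.single i' c.1 + Pi.single j' c.2 : RectTorusSite Ls), (⟨(i', j'), h⟩ : {p : Fin d × Fin d // p.1 < p.2})) := by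
    intro c c' hcc
    have h1 := congrArg (fun p : RectPlaquette Ls => p.1 i') hcc
    have h2 := congrArg (fun p : RectPlaquette Ls => p.1 j') hcc
    simp only [Pi.add_apply, Pi.single_eq_same, Pi.single_eq_of_ne h.ne, Pi.single_eq_of_ne h.ne',
      add_zero, zero_add] at h1 h2
    exact Prod.ext h1 h2
  have := Fintype.card_le_of_injective _ hf
  rwa [Fintype.card_prod, ZMod.card, ZMod.card] at this

/-! ### The polynomial `D̃ = Z⁻ − (−1)^n Z` and the degree bound -/

omit [∀ i, NeZero (Ls i)] in
/-- `(-1)^m = (-1)^n` when `m + n` is even (plumbing). -/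
private theorem neg_one_pow_eq_of_even_add' {m n : ℕ} (h : Even (m + n)) : (-1 : ℝ) ^ m = (-1) ^ n := by
  have h1 : (-1 : ℝ) ^ m * (-1) ^ n = 1 := by rw [← pow_add]; exact h.neg_one_pow
  have h2 : (-1 : ℝ) ^ n * (-1) ^ n = 1 := by rw [← mul_pow]; norm_num
  calc (-1 : ℝ) ^ m = (-1) ^ m * ((-1) ^ n * (-1) ^ n) := by rw [h2, mul_one]
    _ = ((-1) ^ m * (-1) ^ n) * (-1) ^ n := by ring
    _ = (-1) ^ n := by rw [h1, one_mul]

/-- `|S ∩ 𝒱| + |(Λ₂ ∖ S) ∩ 𝒱| = |𝒱|` (plumbing). -/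
private theorem card_inter_add_card_compl_inter (S V : Finset (RectPlaquette Ls)) :
    (S ∩ V).card + ((univ \ S) ∩ V).card = V.card := by
  have h1 : (univ \ S) ∩ V = V \ S := by
    ext p
    simp only [Finset.mem_inter, Finset.mem_sdiff, Finset.mem_univ, true_and]
    tauto
  rw [h1, Finset.inter_comm, add_comm]
  exact Finset.card_sdiff_add_card_inter V S

/-- **Coefficients of `D̃ := Z⁻_𝒱 − (−1)^{|𝒱|} Z` beyond `|Λ₂| − L_iL_j` vanish**: a plaquette set `S` with
`|Λ₂ ∖ S| < L_iL_j` either has `|S ∩ 𝒱| ≡ |𝒱|` (so its two contributions cancel) or `I(S) = 0` (`le_card_compl_of_odd`). -/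
theorem coeff_tilde_eq_zero {m : ℕ} (hm : Fintype.card (RectPlaquette Ls) < m + Ls i * Ls j) :
    (oneCharZtwPoly Ls (rectVortexSheet Ls i j hij) -
        C ((-1 : ℝ) ^ (rectVortexSheet Ls i j hij).card) * oneCharZPoly Ls).coeff m = 0 := by
  rw [coeff_sub, coeff_C_mul, oneCharZtwPoly_coeff, oneCharZPoly_coeff, Finset.mul_sum, ← Finset.sum_sub_distrib]
  refine Finset.sum_eq_zero fun S hS => ?_
  have hSm : S.card = m := (Finset.mem_filter.mp hS).2
  have hsplit := card_inter_add_card_compl_inter Ls S (rectVortexSheet Ls i j hij)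
  rcases Nat.even_or_odd ((univ \ S) ∩ rectVortexSheet Ls i j hij).card with he | ho
  · have hpow : (-1 : ℝ) ^ (S ∩ rectVortexSheet Ls i j hij).card = (-1) ^ (rectVortexSheet Ls i j hij).card := by
      apply neg_one_pow_eq_of_even_add'
      obtain ⟨k, hk⟩ := he
      exact ⟨(S ∩ rectVortexSheet Ls i j hij).card + k, by omega⟩
    rw [hpow]
    ring
  · have hI : rectCharMoment Ls S = 0 := by
      by_contra hI
      have h1 := le_card_compl_of_odd Ls hij hI ho
      have h2 : (univ \ S).card = Fintype.card (RectPlaquette Ls) - S.card := Finset.card_univ_sdiff S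
      have hP0 : 0 < Ls i * Ls j := Nat.pos_of_ne_zero (mul_ne_zero (NeZero.ne _) (NeZero.ne _))
      omega
    rw [hI]
    ring

/-- `deg D̃ ≤ |Λ₂| − L_iL_j`. -/
theorem natDegree_tilde_le :
    (oneCharZtwPoly Ls (rectVortexSheet Ls i j hij) -
        C ((-1 : ℝ) ^ (rectVortexSheet Ls i j hij).card) * oneCharZPoly Ls).natDegree ≤
      Fintype.card (RectPlaquette Ls) - Ls i * Ls j := by
  rw [natDegree_le_iff_coeff_eq_zero]
  intro m hm
  exact coeff_tilde_eq_zero Ls hij (by omega)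

/-- `N_V = D̃′·Z − D̃·Z′` for `D̃ = Z⁻_V − c·Z`, any constant `c` (the Wronskian is blind to the proportional part). -/
theorem twistCensusPoly_eq_tilde (V : Finset (RectPlaquette Ls)) (c : ℝ) :
    twistCensusPoly Ls V = derivative (oneCharZtwPoly Ls V - C c * oneCharZPoly Ls) * oneCharZPoly Ls -
      (oneCharZtwPoly Ls V - C c * oneCharZPoly Ls) * derivative (oneCharZPoly Ls) := by
  unfold twistCensusPoly
  rw [derivative_sub, derivative_C_mul]
  ring

/-- **The «≤» half of the degree law (D), a theorem**: `deg N_{ij} ≤ 2|Λ₂| − 1 − L_iL_j` for every rectangular torus and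
every plane. -/
theorem natDegree_twistCensusPoly_le_degreeLaw :
    (twistCensusPoly Ls (rectVortexSheet Ls i j hij)).natDegree ≤
      2 * Fintype.card (RectPlaquette Ls) - 1 - Ls i * Ls j := by
  set D := oneCharZtwPoly Ls (rectVortexSheet Ls i j hij) -
    C ((-1 : ℝ) ^ (rectVortexSheet Ls i j hij).card) * oneCharZPoly Ls with hD
  have hDdeg : D.natDegree ≤ Fintype.card (RectPlaquette Ls) - Ls i * Ls j := natDegree_tilde_le Ls hij
  have hZ := natDegree_oneCharZPoly_le Ls
  have hZ' := natDegree_derivative_le (oneCharZPoly Ls)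
  have hP := mul_le_card_rectPlaquette Ls i j hij
  rw [twistCensusPoly_eq_tilde Ls _ ((-1 : ℝ) ^ (rectVortexSheet Ls i j hij).card), ← hD]
  by_cases h0 : D.natDegree = 0
  · have hD' : derivative D = 0 := by rw [eq_C_of_natDegree_eq_zero h0, derivative_C]
    rw [hD', zero_mul, zero_sub, natDegree_neg]
    refine natDegree_mul_le.trans ?_
    omega
  · have hD' := natDegree_derivative_le D
    refine (natDegree_sub_le _ _).trans (max_le ?_ ?_)
    · refine natDegree_mul_le.trans ?_
      omega
    · refine natDegree_mul_le.trans ?_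
      omega

/-! ### The conjectured top coefficient -/

/-- **The co-sheet moment sum** `Σ_{|T| = L_iL_j, |T ∩ 𝒱_{ij}| odd} 2^{|Λ₂| − L_iL_j} I(Λ₂ ∖ T)` — the one Haar-moment quantity
the top coefficient depends on (mechanism: the contributing `T` are the `|𝒱|` flat sheets). -/
def cosheetMomentSum : ℝ :=
  ∑ T ∈ ((univ : Finset (RectPlaquette Ls)).powerset).filter
      (fun T => T.card = Ls i * Ls j ∧ Odd (T ∩ rectVortexSheet Ls i j hij).card),
    (2 : ℝ) ^ (Fintype.card (RectPlaquette Ls) - Ls i * Ls j) * rectCharMoment Ls (univ \ T)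

/-- `coeff_{|Λ₂| − L_iL_j} D̃ = −2 (−1)^{|𝒱|} · cosheetMomentSum` (reindex the contributing `S` by their complements `T`). -/
theorem coeff_tilde_top :
    (oneCharZtwPoly Ls (rectVortexSheet Ls i j hij) -
        C ((-1 : ℝ) ^ (rectVortexSheet Ls i j hij).card) * oneCharZPoly Ls).coeff
        (Fintype.card (RectPlaquette Ls) - Ls i * Ls j) =
      -2 * (-1 : ℝ) ^ (rectVortexSheet Ls i j hij).card * cosheetMomentSum Ls hij := by
  set V := rectVortexSheet Ls i j hij with hV
  set Pt := Fintype.card (RectPlaquette Ls) with hPt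
  set P := Ls i * Ls j with hPdef
  have hP : P ≤ Pt := mul_le_card_rectPlaquette Ls i j hij
  -- both sides as sums of `if Odd (...) then ... else 0`
  have hL : (oneCharZtwPoly Ls V - C ((-1 : ℝ) ^ V.card) * oneCharZPoly Ls).coeff (Pt - P) =
      ∑ S ∈ ((univ : Finset (RectPlaquette Ls)).powerset).filter (fun S => S.card = Pt - P),
        (if Odd ((univ \ S) ∩ V).card then
          -2 * (-1 : ℝ) ^ V.card * ((2 : ℝ) ^ (Pt - P) * rectCharMoment Ls S) else 0) := by
    rw [coeff_sub, coeff_C_mul, oneCharZtwPoly_coeff, oneCharZPoly_coeff, Finset.mul_sum, ← Finset.sum_sub_distrib]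
    refine Finset.sum_congr rfl fun S hS => ?_
    have hSm : S.card = Pt - P := (Finset.mem_filter.mp hS).2
    have hsplit := card_inter_add_card_compl_inter Ls S V
    rcases Nat.even_or_odd ((univ \ S) ∩ V).card with he | ho
    · have hpow : (-1 : ℝ) ^ (S ∩ V).card = (-1) ^ V.card := by
        apply neg_one_pow_eq_of_even_add'
        obtain ⟨k, hk⟩ := he
        exact ⟨(S ∩ V).card + k, by omega⟩
      rw [if_neg (Nat.not_odd_iff_even.mpr he), hpow, hSm]
      ring
    · have hpow : (-1 : ℝ) ^ (S ∩ V).card = -(-1) ^ V.card := by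
        have h' : (-1 : ℝ) ^ ((S ∩ V).card + 1) = (-1) ^ V.card := by
          apply neg_one_pow_eq_of_even_add'
          obtain ⟨k, hk⟩ := ho
          exact ⟨(S ∩ V).card + k + 1, by omega⟩
        rw [pow_succ] at h'
        linarith
      rw [if_pos ho, hpow, hSm]
      ring
  have hR : -2 * (-1 : ℝ) ^ V.card * cosheetMomentSum Ls hij =
      ∑ T ∈ ((univ : Finset (RectPlaquette Ls)).powerset).filter (fun T => T.card = P),
        (if Odd (T ∩ V).card then
          -2 * (-1 : ℝ) ^ V.card * ((2 : ℝ) ^ (Pt - P) * rectCharMoment Ls (univ \ T)) else 0) := by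
    rw [cosheetMomentSum, ← hV, ← hPt, ← hPdef, ← Finset.filter_filter, Finset.sum_filter, Finset.mul_sum]
    refine Finset.sum_congr rfl fun T _ => ?_
    split_ifs <;> ring
  rw [hL, hR]
  -- reindex by complements
  refine Finset.sum_bij' (fun S _ => univ \ S) (fun T _ => univ \ T) ?_ ?_ ?_ ?_ ?_
  · intro S hS
    have hSm : S.card = Pt - P := (Finset.mem_filter.mp hS).2
    simp only [Finset.mem_filter, Finset.mem_powerset, Finset.subset_univ, true_and]
    rw [Finset.card_univ_sdiff, ← hPt, hSm]
    omega
  · intro T hT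
    have hTm : T.card = P := (Finset.mem_filter.mp hT).2
    simp only [Finset.mem_filter, Finset.mem_powerset, Finset.subset_univ, true_and]
    rw [Finset.card_univ_sdiff, ← hPt, hTm]
  · intro S _
    simp
  · intro T _
    simp
  · intro S _
    simp

/-- `coeff_{|Λ₂|} Z = 2^{|Λ₂|} I(Λ₂)`. -/
theorem oneCharZPoly_coeff_card :
    (oneCharZPoly Ls).coeff (Fintype.card (RectPlaquette Ls)) =
      (2 : ℝ) ^ Fintype.card (RectPlaquette Ls) * rectCharMoment Ls univ := by
  have hfilter : ((univ : Finset (RectPlaquette Ls)).powerset).filter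
      (fun S => S.card = Fintype.card (RectPlaquette Ls)) = {univ} := by
    ext S
    simp only [Finset.mem_filter, Finset.mem_powerset, Finset.subset_univ, true_and, Finset.mem_singleton]
    constructor
    · intro h; exact Finset.eq_univ_of_card S h
    · intro h; rw [h, Finset.card_univ]
  rw [oneCharZPoly_coeff, hfilter, Finset.sum_singleton, Finset.card_univ]

/-- **The coefficient of `N_{ij}` in the conjectured top degree** `2|Λ₂| − 1 − L_iL_j` (for `L_iL_j < |Λ₂|`, automatic when
`d ≥ 3`): `= 2 · (L_iL_j) · (−1)^{|𝒱|} · cosheetMomentSum · 2^{|Λ₂|} I(Λ₂)`.  Hence (D) ⟺ `cosheetMomentSum · I(Λ₂) ≠ 0`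
and (D) ∧ (S∞) ⟺ `0 < cosheetMomentSum · I(Λ₂)` (given `natDegree_twistCensusPoly_le_degreeLaw`). -/
theorem twistCensusPoly_coeff_degreeLaw (hP : Ls i * Ls j < Fintype.card (RectPlaquette Ls)) :
    (twistCensusPoly Ls (rectVortexSheet Ls i j hij)).coeff (2 * Fintype.card (RectPlaquette Ls) - 1 - Ls i * Ls j) =
      2 * ((Ls i * Ls j : ℕ) : ℝ) * (-1 : ℝ) ^ (rectVortexSheet Ls i j hij).card * cosheetMomentSum Ls hij *
        ((2 : ℝ) ^ Fintype.card (RectPlaquette Ls) * rectCharMoment Ls univ) := by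
  set D := oneCharZtwPoly Ls (rectVortexSheet Ls i j hij) -
    C ((-1 : ℝ) ^ (rectVortexSheet Ls i j hij).card) * oneCharZPoly Ls with hD
  set Pt := Fintype.card (RectPlaquette Ls) with hPt
  set P := Ls i * Ls j with hPdef
  obtain ⟨k, hk⟩ : ∃ k, Pt - P = k + 1 := ⟨Pt - P - 1, by omega⟩
  have hDdeg : D.natDegree ≤ k + 1 := hk ▸ natDegree_tilde_le Ls hij
  have hD'deg : (derivative D).natDegree ≤ k := (natDegree_derivative_le D).trans (by omega)
  have hZ : (oneCharZPoly Ls).natDegree ≤ Pt := natDegree_oneCharZPoly_le Ls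
  have hZ' : (derivative (oneCharZPoly Ls)).natDegree ≤ Pt - 1 := (natDegree_derivative_le _).trans (by omega)
  have hDtop : D.coeff (k + 1) = -2 * (-1 : ℝ) ^ (rectVortexSheet Ls i j hij).card * cosheetMomentSum Ls hij := by
    rw [← hk]; exact coeff_tilde_top Ls hij
  have hZtop := oneCharZPoly_coeff_card Ls
  rw [← hPt] at hZtop
  have t1 : (derivative D * oneCharZPoly Ls).coeff (k + Pt) = D.coeff (k + 1) * ((k : ℝ) + 1) *
      (oneCharZPoly Ls).coeff Pt := by
    rw [coeff_mul_add_eq_of_natDegree_le hD'deg hZ, coeff_derivative]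
  have t2 : (D * derivative (oneCharZPoly Ls)).coeff (k + Pt) =
      D.coeff (k + 1) * ((oneCharZPoly Ls).coeff Pt * (Pt : ℝ)) := by
    rw [show k + Pt = (k + 1) + (Pt - 1) by omega, coeff_mul_add_eq_of_natDegree_le hDdeg hZ', coeff_derivative,
      Nat.sub_add_cancel (by omega : 1 ≤ Pt)]
    push_cast [Nat.cast_sub (by omega : 1 ≤ Pt)]
    ring
  rw [twistCensusPoly_eq_tilde Ls _ ((-1 : ℝ) ^ (rectVortexSheet Ls i j hij).card), ← hD,
    show 2 * Pt - 1 - P = k + Pt by omega, coeff_sub, t1, t2, hDtop, hZtop]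
  have hk' : ((k : ℝ) + 1) = (Pt : ℝ) - (P : ℝ) := by
    have : ((Pt - P : ℕ) : ℝ) = (k : ℝ) + 1 := by exact_mod_cast hk
    rw [Nat.cast_sub hP.le] at this
    linarith
  rw [hk']
  ring

end Summit.Ventures.YMGap.Census

end
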